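import Summits.AnomalousDissipation.AnomalousDissipation.Theses.TaylorCertificates
import Literature.Analysis.FunctionSpaces.TorusSobolevSpaceProofs

/-!
# Route TaylorCertificates — the support `TargetImpliesSteady`, dependency-light proof

A second, self-contained proof of the route declaration
`Summit.AnomalousDissipation.AnomalousDissipation.Theses.TaylorCertificates.TargetImpliesSteady`
(item stmt-AnomalousDissipation-14883), importing nothing beyond the route file and the Literature
discharge `TorusSobolevSpaceProofs` (`𝒱 ⊆ V`).

The first proof (`Theorems/TaylorCertificatesTargetImpliesSteady.lean`, `TargetImpliesSteady_proof`,
accepted) is five lines over `KolmogorovFloorEnsembleCeiling/Negative/Planar.loudBoundedSteadyAt_of_floor_ceiling`;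
that nested `Negative/` chain imports `FloorCertificate/Negative/WeakDuality.lean`, which no longer
elaborates after the route repair dropped the declaration `FloorCertificate` (rev 13), so the first
module has no olean on the hub and the item cannot be closed against it. This twin re-derives the
three ingredients at `d = Fin 3` from the Literature layer alone:

* a smooth divergence-free mean-zero classical steady state `u` of `NS_ν(f)`
  (`∫⟪νΔu − (u·∇)u + f, w⟫ = 0` on smooth divergence-free mean-zero `w`) is carried by a state
  `U ∈ V` of `H` which is an `H`-steady weak solution (`Torus.IsSteadyWeakSolution`: Green's second
  identity `integral_inner_laplacian_comm` and the antisymmetry of the trilinear form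
  `integral_inner_convect_eq_neg` move all derivatives onto the test field);
* FLOOR ⇒ LOUD (Dirac case of weak duality): at `U` the generator pairing vanishes (`Φ₁'(U) ∈ 𝒱`),
  the energy channel `(U,f) − ν‖∇U‖²` vanishes (Temam's energy equation of steady weak solutions,
  `IsSteadyWeakSolution.energy_eq'`), `U` has finite enstrophy and lies in the Leray ball
  `|U|² ≤ 16‖f‖²/ν²` (energy equation + Poincaré `norm_sq_le_toReal_eGradNormSq`), so the floor
  inequality at `U` reads `ε₀ ≤ ν‖∇U‖²`;
* CEILING ⇒ BOUNDED: the Dirac mass at `U` is a stationary statistical solution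
  (`isStationaryStatisticalSolution_dirac_holds`, FMRT IV §1.2) with integrable energy, so the
  ensemble ceiling gives `‖U‖² ≤ E`;

and transports both back to `u` along `U = u` a.e. (spectral = classical enstrophy on smooth fields,
`gradNormSq_eq_toReal_eGradNormSq_holds`).
-/

noncomputable section

namespace Summit.AnomalousDissipation.AnomalousDissipation.Theorems

-- the mandated namespace `Summit.<Summit>.<Problem>.Theorems` repeats `AnomalousDissipation` (single-problem summit)
set_option linter.dupNamespace false

open MeasureTheory
open scoped InnerProductSpace ENNReal
open Literature.Analysis.FunctionSpaces Literature.Analysis.FunctionSpaces.Torus Literature.Analysis.FluidPDE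
open Summit.AnomalousDissipation.AnomalousDissipation.Theses.TaylorCertificates

namespace TargetImpliesSteadyDirect

/-- The squared `H`-norm of a state is the energy of any a.e.-representative. -/
theorem norm_sq_eq_integral_of_ae_rep {u : Torus.energySpace (Fin 3)} {w : UnitAddTorus (Fin 3) → EuclideanSpace ℝ (Fin 3)}
    (hu : ((u : Lp (EuclideanSpace ℝ (Fin 3)) 2 (volume : Measure (UnitAddTorus (Fin 3)))) : UnitAddTorus (Fin 3) → EuclideanSpace ℝ (Fin 3)) =ᵐ[volume] w) :
    ‖u‖ ^ 2 = ∫ x, ‖w x‖ ^ 2 := by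
  rw [Submodule.coe_norm, ← real_inner_self_eq_norm_sq, MeasureTheory.L2.inner_def]
  refine integral_congr_ae ?_
  filter_upwards [hu] with x hx
  rw [hx, real_inner_self_eq_norm_sq]

/-- **Classical steady states are `H`-steady weak solutions in `V`.** A smooth divergence-free mean-zero
field `u` with `∫⟪νΔu − (u·∇)u + f, w⟫ = 0` for all smooth divergence-free mean-zero `w` (`f` smooth) is
the a.e.-representative of a state `U ∈ V` of `H` with `Torus.IsSteadyWeakSolution ν f U`. -/
theorem exists_steadyState_of_classical {ν : ℝ} {f u : UnitAddTorus (Fin 3) → EuclideanSpace ℝ (Fin 3)}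
    (hf : IsSmooth f) (hu : IsSmooth u) (hdiv : IsDivFree u) (hmean : HasZeroMean u)
    (hsteady : ∀ w : UnitAddTorus (Fin 3) → EuclideanSpace ℝ (Fin 3), IsSmooth w → IsDivFree w → HasZeroMean w →
      ∫ x, ⟪ν • Torus.laplacian u x - Torus.convect u u x + f x, w x⟫_ℝ = 0) :
    ∃ U : Torus.energySpace (Fin 3),
      ((U : Lp (EuclideanSpace ℝ (Fin 3)) 2 (volume : Measure (UnitAddTorus (Fin 3)))) : UnitAddTorus (Fin 3) → EuclideanSpace ℝ (Fin 3)) =ᵐ[volume] u ∧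
      (U : Lp (EuclideanSpace ℝ (Fin 3)) 2 (volume : Measure (UnitAddTorus (Fin 3)))) ∈ Torus.energySpaceV (Fin 3) ∧
      Torus.IsSteadyWeakSolution ν f U := by
  have hu2 : MemLp u 2 volume := hu.memLp 2
  have hrep : ((hu2.toLp u : Lp (EuclideanSpace ℝ (Fin 3)) 2 (volume : Measure (UnitAddTorus (Fin 3)))) : UnitAddTorus (Fin 3) → EuclideanSpace ℝ (Fin 3)) =ᵐ[volume] u :=
    hu2.coeFn_toLp
  have hH : hu2.toLp u ∈ Torus.energySpace (Fin 3) :=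
    Torus.smoothSolenoidal_subset_energySpace ⟨u, hu, hdiv, hmean, hrep⟩
  refine ⟨⟨hu2.toLp u, hH⟩, hrep, Torus.smoothSolenoidal_subset_energySpaceV_holds ⟨u, hu, hdiv, hmean, hrep⟩,
    fun w hw hdw hzw => ?_⟩
  -- the generator pairing at `U`, written on the representative `u`
  have h1 : (∫ x, ⟪(((⟨hu2.toLp u, hH⟩ : Torus.energySpace (Fin 3)) : Lp (EuclideanSpace ℝ (Fin 3)) 2 (volume : Measure (UnitAddTorus (Fin 3)))) : UnitAddTorus (Fin 3) → EuclideanSpace ℝ (Fin 3)) x, Torus.laplacian w x⟫_ℝ) =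
      ∫ x, ⟪u x, Torus.laplacian w x⟫_ℝ := by
    refine integral_congr_ae ?_
    filter_upwards [hrep] with x hx
    rw [← hx]
  have h2 : (∫ x, ⟪Torus.fderiv w x ((((⟨hu2.toLp u, hH⟩ : Torus.energySpace (Fin 3)) : Lp (EuclideanSpace ℝ (Fin 3)) 2 (volume : Measure (UnitAddTorus (Fin 3)))) : UnitAddTorus (Fin 3) → EuclideanSpace ℝ (Fin 3)) x),
      (((⟨hu2.toLp u, hH⟩ : Torus.energySpace (Fin 3)) : Lp (EuclideanSpace ℝ (Fin 3)) 2 (volume : Measure (UnitAddTorus (Fin 3)))) : UnitAddTorus (Fin 3) → EuclideanSpace ℝ (Fin 3)) x⟫_ℝ) =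
      ∫ x, ⟪Torus.fderiv w x (u x), u x⟫_ℝ := by
    refine integral_congr_ae ?_
    filter_upwards [hrep] with x hx
    rw [← hx]
  unfold Torus.nsGeneratorPairing Torus.inertialPairing
  rw [h1, h2]
  -- all derivatives back onto `u`: `(f, w) + ν (u, Δw) + ∫⟪Dw·u, u⟫ = ∫⟪νΔu − (u·∇)u + f, w⟫ = 0`
  have hlap : ∫ x, ⟪u x, Torus.laplacian w x⟫_ℝ = ∫ x, ⟪Torus.laplacian u x, w x⟫_ℝ :=
    (Torus.integral_inner_laplacian_comm hu hw).symm
  have hconv : ∫ x, ⟪Torus.fderiv w x (u x), u x⟫_ℝ = -∫ x, ⟪Torus.convect u u x, w x⟫_ℝ := by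
    change ∫ x, ⟪Torus.convect u w x, u x⟫_ℝ = _
    rw [Torus.integral_inner_convect_eq_neg hu hdiv hw hu]
    congr 1
    exact integral_congr_ae (ae_of_all _ fun x => real_inner_comm _ _)
  have i1 : Integrable (fun x => ⟪ν • Torus.laplacian u x, w x⟫_ℝ) volume := by
    have := ((hu.laplacian.inner hw).integrable).const_mul ν
    refine this.congr (ae_of_all _ fun x => ?_)
    simp [inner_smul_left]
  have i2 : Integrable (fun x => ⟪Torus.convect u u x, w x⟫_ℝ) volume := ((hu.convect hu).inner hw).integrable
  have i3 : Integrable (fun x => ⟪f x, w x⟫_ℝ) volume := (hf.inner hw).integrable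
  have hsplit : ∫ x, ⟪ν • Torus.laplacian u x - Torus.convect u u x + f x, w x⟫_ℝ =
      (∫ x, ⟪f x, w x⟫_ℝ) + ν * (∫ x, ⟪u x, Torus.laplacian w x⟫_ℝ) + ∫ x, ⟪Torus.fderiv w x (u x), u x⟫_ℝ := by
    simp_rw [inner_add_left, inner_sub_left]
    rw [integral_add ?_ i3, integral_sub i1 i2, hlap, hconv]
    · have : ∫ x, ⟪ν • Torus.laplacian u x, w x⟫_ℝ = ν * ∫ x, ⟪Torus.laplacian u x, w x⟫_ℝ := by
        rw [← integral_const_mul]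
        refine integral_congr_ae (ae_of_all _ fun x => ?_)
        simp [inner_smul_left]
      rw [this]
      ring
    · exact i1.sub i2
  rw [← hsplit]
  exact hsteady w hw hdw hzw

/-- States of the FMRT support ball `|u| ≤ ‖f‖/(4π²ν)` lie in the Leray ball `|u|² ≤ 16‖f‖²/ν²`. -/
theorem leray_ball_of_norm_le {ν : ℝ} (hν : 0 < ν) {f : UnitAddTorus (Fin 3) → EuclideanSpace ℝ (Fin 3)} (hf : MemLp f 2 volume)
    {u : Torus.energySpace (Fin 3)} (hu : ‖u‖ ≤ ‖hf.toLp f‖ / (4 * Real.pi ^ 2 * ν)) :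
    ‖u‖ ^ 2 ≤ 16 * (∫ x, ‖f x‖ ^ 2) / ν ^ 2 := by
  have hF : ‖hf.toLp f‖ ^ 2 = ∫ x, ‖f x‖ ^ 2 := by
    rw [Torus.norm_toLp_eq_sqrt hf, Real.sq_sqrt (integral_nonneg fun x => by positivity)]
  have h1 : ‖u‖ ^ 2 ≤ (‖hf.toLp f‖ / (4 * Real.pi ^ 2 * ν)) ^ 2 := pow_le_pow_left₀ (norm_nonneg _) hu 2
  have h2 : (‖hf.toLp f‖ / (4 * Real.pi ^ 2 * ν)) ^ 2 ≤ 16 * ‖hf.toLp f‖ ^ 2 / ν ^ 2 := by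
    rw [div_pow, mul_pow, div_le_div_iff₀ (by positivity) (by positivity)]
    have h36 : (1 : ℝ) ≤ 4 * Real.pi ^ 2 := by nlinarith [Real.pi_gt_three]
    have hsq : (1 : ℝ) ≤ (4 * Real.pi ^ 2) ^ 2 := one_le_pow₀ h36
    have hc16 : (1 : ℝ) ≤ 16 * (4 * Real.pi ^ 2) ^ 2 := by linarith
    have key : 0 ≤ ‖hf.toLp f‖ ^ 2 * ν ^ 2 * (16 * (4 * Real.pi ^ 2) ^ 2 - 1) :=
      mul_nonneg (mul_nonneg (sq_nonneg _) (sq_nonneg _)) (sub_nonneg.2 hc16)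
    nlinarith [key]
  rw [← hF]; exact h1.trans h2

/-- **FLOOR ⇒ LOUD at a steady state** (Dirac case of weak duality): if `(Φ₁, θ₁)` satisfies the floor
inequality of the target at every finite-enstrophy state of the Leray ball (`ν > 0`, `f ∈ L²`), then every
steady weak solution `u ∈ V` of `NS_ν(f)` has `ε₀ ≤ ν‖∇u‖²`: the generator term vanishes (`Φ₁'(u) ∈ 𝒱`),
the energy channel vanishes (energy equation `ν‖∇u‖² = (u,f)`), and `u` lies in the Leray ball (energy
equation + Poincaré). -/
theorem floor_le_dissipation_of_steady {ν : ℝ} (hν : 0 < ν) {f : UnitAddTorus (Fin 3) → EuclideanSpace ℝ (Fin 3)} (hf : MemLp f 2 volume)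
    {ε₀ θ₁ : ℝ} {Φ₁ : Torus.CylindricalTest (Fin 3)}
    (hfloor : ∀ u : Torus.energySpace (Fin 3),
      Torus.eGradNormSq ((u : Lp (EuclideanSpace ℝ (Fin 3)) 2 (volume : Measure (UnitAddTorus (Fin 3)))) : UnitAddTorus (Fin 3) → EuclideanSpace ℝ (Fin 3)) ≠ ⊤ →
      ‖u‖ ^ 2 ≤ 16 * (∫ x, ‖f x‖ ^ 2) / ν ^ 2 →
      ε₀ ≤ ν * (Torus.eGradNormSq ((u : Lp (EuclideanSpace ℝ (Fin 3)) 2 (volume : Measure (UnitAddTorus (Fin 3)))) : UnitAddTorus (Fin 3) → EuclideanSpace ℝ (Fin 3))).toReal +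
        Torus.nsGeneratorPairing ν f u (Φ₁.grad u) +
        2 * θ₁ * (Torus.pairing (u : Lp (EuclideanSpace ℝ (Fin 3)) 2 (volume : Measure (UnitAddTorus (Fin 3)))) f -
          ν * (Torus.eGradNormSq ((u : Lp (EuclideanSpace ℝ (Fin 3)) 2 (volume : Measure (UnitAddTorus (Fin 3)))) : UnitAddTorus (Fin 3) → EuclideanSpace ℝ (Fin 3))).toReal))
    {u : Torus.energySpace (Fin 3)} (hV : (u : Lp (EuclideanSpace ℝ (Fin 3)) 2 (volume : Measure (UnitAddTorus (Fin 3)))) ∈ Torus.energySpaceV (Fin 3))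
    (hu : Torus.IsSteadyWeakSolution ν f u) :
    ε₀ ≤ ν * (Torus.eGradNormSq ((u : Lp (EuclideanSpace ℝ (Fin 3)) 2 (volume : Measure (UnitAddTorus (Fin 3)))) : UnitAddTorus (Fin 3) → EuclideanSpace ℝ (Fin 3))).toReal := by
  have hfin : Torus.eGradNormSq ((u : Lp (EuclideanSpace ℝ (Fin 3)) 2 (volume : Measure (UnitAddTorus (Fin 3)))) : UnitAddTorus (Fin 3) → EuclideanSpace ℝ (Fin 3)) ≠ ⊤ :=
    hV.2.eGradNormSq_lt_top.ne
  have henergy : ν * (Torus.eGradNormSq ((u : Lp (EuclideanSpace ℝ (Fin 3)) 2 (volume : Measure (UnitAddTorus (Fin 3)))) : UnitAddTorus (Fin 3) → EuclideanSpace ℝ (Fin 3))).toReal =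
      Torus.pairing (u : Lp (EuclideanSpace ℝ (Fin 3)) 2 (volume : Measure (UnitAddTorus (Fin 3)))) f :=
    Torus.IsSteadyWeakSolution.energy_eq' (by simp) hf hV hu
  have hgen : Torus.nsGeneratorPairing ν f u (Φ₁.grad u) = 0 :=
    hu _ (Torus.CylindricalTest.isSmooth_grad_holds Φ₁ u) (Torus.CylindricalTest.isDivFree_grad_holds Φ₁ u)
      (Torus.CylindricalTest.hasZeroMean_grad_holds Φ₁ u)
  -- the Leray ball from the energy equation and Poincaré
  have hball : ‖u‖ ^ 2 ≤ 16 * (∫ x, ‖f x‖ ^ 2) / ν ^ 2 := by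
    refine leray_ball_of_norm_le hν hf ?_
    have hP := Torus.norm_sq_le_toReal_eGradNormSq u hfin
    have hp : Torus.pairing (u : Lp (EuclideanSpace ℝ (Fin 3)) 2 (volume : Measure (UnitAddTorus (Fin 3)))) f ≤ ‖u‖ * ‖hf.toLp f‖ :=
      (le_abs_self _).trans (Torus.abs_pairing_coe_le hf u)
    rw [le_div_iff₀ (by positivity)]
    by_cases h0 : ‖u‖ = 0
    · rw [h0, zero_mul]; exact norm_nonneg _
    · have hpos : 0 < ‖u‖ := lt_of_le_of_ne (norm_nonneg _) (Ne.symm h0)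
      have : ν * (4 * Real.pi ^ 2 * ‖u‖ ^ 2) ≤ ‖u‖ * ‖hf.toLp f‖ := by nlinarith
      nlinarith
  have h := hfloor u hfin hball
  rw [hgen, ← henergy] at h
  linarith

/-- **CEILING ⇒ BOUNDED at a steady state**: if every stationary statistical solution of `NS_ν(f)` with
integrable energy has mean energy `≤ E`, then every steady weak solution `u ∈ V` has `‖u‖² ≤ E` (the Dirac
mass at `u` is a stationary statistical solution, FMRT IV §1.2). -/
theorem norm_sq_le_of_ensemble_ceiling {ν : ℝ} (hν : 0 < ν)
    {f : UnitAddTorus (Fin 3) → EuclideanSpace ℝ (Fin 3)} (hf : MemLp f 2 volume) {E : ℝ}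
    (h : ∀ μ : Measure (Torus.energySpace (Fin 3)), Torus.IsStationaryStatisticalSolution ν f μ →
      Integrable (fun v : Torus.energySpace (Fin 3) => ‖v‖ ^ 2) μ → Torus.ensembleEnergy μ ≤ E)
    {u : Torus.energySpace (Fin 3)}
    (hV : (u : Lp (EuclideanSpace ℝ (Fin 3)) 2 (volume : Measure (UnitAddTorus (Fin 3)))) ∈ Torus.energySpaceV (Fin 3))
    (hu : Torus.IsSteadyWeakSolution ν f u) : ‖u‖ ^ 2 ≤ E := by
  haveI : MeasurableSingletonClass (Torus.energySpace (Fin 3)) := OpensMeasurableSpace.toMeasurableSingletonClass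
  have hμ := Torus.isStationaryStatisticalSolution_dirac_holds hν.le hf (by simp) hV hu
  have := h _ hμ (Torus.integrable_dirac u _)
  unfold Torus.ensembleEnergy at this
  rwa [integral_dirac] at this

end TargetImpliesSteadyDirect

open TargetImpliesSteadyDirect in
/-- **The target implies loud-and-bounded steady states, for the same force** (dependency-light twin of
`TargetImpliesSteady_proof`, item stmt-AnomalousDissipation-14883).
`FloorCertificateEnsembleCeiling → SteadyStatesLoudBounded`: keep the witness force `f` and the constants
`ε₀, E, ν₀`; at `ν ∈ (0, ν₀)` a smooth classical steady state `u` of `NS_ν(f)` is carried by an `H`-steady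
weak solution `U ∈ V` (`exists_steadyState_of_classical`); the floor certificate `(Φ₁, θ₁)` of the target
gives `ε₀ ≤ ν‖∇U‖²` (`floor_le_dissipation_of_steady`) and its ensemble ceiling gives `‖U‖² ≤ E`
(`norm_sq_le_of_ensemble_ceiling`); both transport back to `u` along `U = u` a.e. -/
theorem TargetImpliesSteady_direct_proof :
    Summit.AnomalousDissipation.AnomalousDissipation.Theses.TaylorCertificates.TargetImpliesSteady := by
  unfold TargetImpliesSteady
  rintro ⟨f, hf₁, hf₂, hf₃, ε₀, E, ν₀, hε, hν₀, h⟩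
  refine ⟨f, hf₁, hf₂, hf₃, ε₀, E, ν₀, hε, hν₀, fun ν hν hνν u hu hdiv hmean hsteady => ?_⟩
  obtain ⟨⟨Φ₁, θ₁, -, hfloor⟩, hceil⟩ := h ν hν hνν
  obtain ⟨U, hU, hV, hUsteady⟩ := exists_steadyState_of_classical hf₁ hu hdiv hmean hsteady
  have hf2 : MemLp f 2 volume := hf₁.memLp 2
  have hloud := floor_le_dissipation_of_steady hν hf2 hfloor hV hUsteady
  have hbdd := norm_sq_le_of_ensemble_ceiling hν hf2 hceil hV hUsteady
  -- the spectral enstrophy depends only on the a.e.-class: transport it to the smooth representative `u`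
  have hgrad : Torus.eGradNormSq ((U : Lp (EuclideanSpace ℝ (Fin 3)) 2 (volume : Measure (UnitAddTorus (Fin 3)))) : UnitAddTorus (Fin 3) → EuclideanSpace ℝ (Fin 3)) =
      Torus.eGradNormSq u := by
    unfold Torus.eGradNormSq Torus.eHomSobolevSeminorm
    have hc : (EuclideanSpace.complexify ∘ ((U : Lp (EuclideanSpace ℝ (Fin 3)) 2 (volume : Measure (UnitAddTorus (Fin 3)))) : UnitAddTorus (Fin 3) → EuclideanSpace ℝ (Fin 3))) =ᵐ[volume]
        (EuclideanSpace.complexify ∘ u) := by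
      filter_upwards [hU] with x hx
      simp only [Function.comp_apply, hx]
    simp_rw [Torus.mFourierCoeff_congr_ae hc]
  rw [hgrad, ← Torus.gradNormSq_eq_toReal_eGradNormSq_holds hu] at hloud
  rw [norm_sq_eq_integral_of_ae_rep hU] at hbdd
  exact ⟨hloud, hbdd⟩

end Summit.AnomalousDissipation.AnomalousDissipation.Theorems
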